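import Summits.QuantumFields.YangMills.Theorems.SwapVirialDeficitNearlyCommutingThreeCeiling
import Summits.QuantumFields.YangMills.Theorems.UV3WindowNetSU2
import HarnessLib

/-!
# The σ-twisted four-leader small ball, CEILING side — I: quaternion algebra and the straightened coordinates

THE σ-TWISTED FOUR-LEADER CEILING (four files `…SigmaTwistedLetterCeiling{Algebra,Shells,Haar,}.lean`): the product Haar mass of the quadruples
`(C₀, C₁, C₂, C₃) ∈ SU(2)⁴` obeying the flat-connection relations of the swap-glued femto ring up to `t` — `C₀, C₁, C₂` pairwise commuting up to
`t`, and `‖q₃q₁ − q₀q₃‖, ‖q₃q₀ − q₁q₃‖, ‖q₃q₂ − q₂q₃‖ ≤ t` for the seam letter (`t a t⁻¹ = b`, `t b t⁻¹ = a`, `t c = c t` in `ℤ³ ⋊_σ ℤ`) — is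
`≤ C·t⁷` (no logarithm), the SAME event as the floor ✓`SigmaTwistedLetterFloor.haar_pi_sigmaTwisted_ge` (w2 g54): the zero-mode block of the
σ-glued ring is two-sided `≍ t⁷`, the stiffness direction of crux ⟨stmt-QuantumFields-24197⟩ `SwapVirialDeficit.SwapGluedStiffness` at the
zero-mode level.  NOT «three-letter ceiling × ball» (the Weyl stratum `(e^{θi}, e^{−θi}, 1, j)` satisfies all six relations exactly while
`[a, t] = 2 sin θ`; w2 g54's caveat): the reduction is — (i) the first twisted relation slaves `C₁` to the `t`-ball about `q̄₃ q₀ q₃` (Fubini over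
`C₁` first, `32t³`); (ii) where `|re q₃| ≥ 1/2` the anticommutator identity `‖q₃D + Dq₃‖ ≥ 2|re q₃|·‖D‖` (`D = q₁ − q₀`) makes the triple
`(q₀, q₂, q₃)` pairwise commute up to `3t` (✓`haar_pi_nearlyCommuting_three_le`: `C₃·81t⁴`); (iii) where `|re q₃| < 1/2` the FOUR load-bearing
constraints (b) `‖[q₃,q₂]‖ ≤ t`, (c) `|re q₃|·‖[q₃,q₀]‖ ≤ 2t`, (d) `‖[q₀, q̄₃q₀q₃]‖ ≤ 3t`, (a) `‖[q₀,q₂]‖ ≤ t` confine, in coordinates straightened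
along the axis of `q₃`, the transversal part `m₀` of `q₀` to dyadic shells on which the axial part of `q₀` is `≤ t/m₀`, the axial part of `q₂`
is `≤ 2t/m₀`, the transversal part of `q₂` is `≤ t`, and `|re q₃| ≤ 2t/m₀`: shell mass `2048c²t⁴` against slab mass `64c·t·2^k`, a GEOMETRIC sum
`≤ 262144c³t⁴`, plus the core `256c²t⁴` — dropping any one of the four would produce a spurious `log` or the exponent `6`.

This file (pure quaternion algebra, no measure theory): §1 the anticommutator identity `‖xD + Dx‖² = 4(re x)²‖D‖² + 4((Im x·Im D)² +
(re D)²‖Im x‖²)`, the conjugate by an axial unit `c` (`16 (im_I c)² (im_I y)² |im_JK y|² ≤ ‖[y, c̄yc]‖²`), commutator components; §2 the pointwise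
consequences of the six relations (region A `‖[q₃,q₀]‖ ≤ 3t`, constraints (c) and (d), the slaved letter `‖q₁ − q̄₃q₀q₃‖ = ‖q₃q₁ − q₀q₃‖`);
§3 the four constraints in ball-model coordinates straightened along the axis of `q₃` (✓`exists_unit_straighten`, ✓`comm_conj_of_norm_eq_one`).
HONEST LABEL: finite-dimensional Haar-volume bookkeeping toward the fixed-`L` zero-mode factor of the swap-glued femto ring (a prediction row of a
DRAFT line); nothing about ⟨24197⟩/⟨24194⟩/⟨24497⟩ or any rung is proved; the Yang–Mills mass gap is NOT proved; no summit is proved by a line.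
Seat ym-line-sfw-p2 g93 (LEAD of unit sfw-p2, free hands; `--supports stmt-QuantumFields-24197`).  THEOREMS ONLY (0 `def`, 0 `sorry`),
standard axioms.  References: [cite: Vanbaal2001]; [cite: Luscher1983, §2]; [cite: GonzalezarroyoAltes1988]; [folklore].
-/

set_option autoImplicit false

noncomputable section

open MeasureTheory Quaternion Set
open scoped Quaternion ENNReal BigOperators
open Literature.MathematicalPhysics.QuantumLattice
open Literature.MathematicalPhysics.QuantumFieldTheory (haarProbability)
open Summit.QuantumFields.YangMills.Theorems.SwapTwistDeficit.ToronLog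
open Summit.QuantumFields.YangMills.Theorems.ToronValleyVolume.NearlyCommutingCeiling
open Summit.QuantumFields.YangMills.Theorems.SwapVirialDeficit
open Summit.QuantumFields.YangMills.Theorems.UV3WindowNetSU2 (abs_imI_le_norm abs_imJ_le_norm abs_imK_le_norm)

namespace Summit.QuantumFields.YangMills.Theorems.SwapVirialDeficit.SigmaTwistedCeiling

/-! ## §1 Quaternion algebra: the anticommutator, the straightened conjugate, commutator components -/

/-- **The anticommutator identity**: `‖xD + Dx‖² = 4(re x)²‖D‖² + 4((Im x · Im D)² + (re D)²‖Im x‖²)`; in particular the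
anticommutator of `x` is invertible with norm `≥ 2|re x|` on all of `ℍ`. [folklore] -/
theorem norm_anticomm_sq (x D : ℍ) :
    ‖x * D + D * x‖ ^ 2 = 4 * x.re ^ 2 * ‖D‖ ^ 2 +
      4 * ((x.imI * D.imI + x.imJ * D.imJ + x.imK * D.imK) ^ 2 + D.re ^ 2 * (x.imI ^ 2 + x.imJ ^ 2 + x.imK ^ 2)) := by
  have h : ‖x * D + D * x‖ ^ 2 = (x * D + D * x).re ^ 2 + (x * D + D * x).imI ^ 2 + (x * D + D * x).imJ ^ 2 +
      (x * D + D * x).imK ^ 2 := by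
    rw [sq, ← Quaternion.normSq_eq_norm_mul_self, Quaternion.normSq_def']
  rw [h, sq_norm_eq_sum_sq D]
  simp only [Quaternion.re_add, Quaternion.imI_add, Quaternion.imJ_add, Quaternion.imK_add,
    Quaternion.re_mul, Quaternion.imI_mul, Quaternion.imJ_mul, Quaternion.imK_mul]
  ring

/-- `2|re x|·‖D‖ ≤ ‖xD + Dx‖`. [folklore] -/
theorem two_mul_abs_re_mul_norm_le_norm_anticomm (x D : ℍ) : 2 * |x.re| * ‖D‖ ≤ ‖x * D + D * x‖ := by
  have h := norm_anticomm_sq x D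
  have h1 : (2 * |x.re| * ‖D‖) ^ 2 ≤ ‖x * D + D * x‖ ^ 2 := by
    rw [h, mul_pow, mul_pow, sq_abs]
    nlinarith [sq_nonneg (x.imI * D.imI + x.imJ * D.imJ + x.imK * D.imK), sq_nonneg D.re,
      sq_nonneg x.imI, sq_nonneg x.imJ, sq_nonneg x.imK, mul_nonneg (sq_nonneg D.re) (add_nonneg (add_nonneg (sq_nonneg x.imI) (sq_nonneg x.imJ)) (sq_nonneg x.imK))]
  exact (pow_le_pow_iff_left₀ (by positivity) (norm_nonneg _) two_ne_zero).1 h1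

/-- The straightened conjugate: for an axial `c` (`im_J c = im_K c = 0`), `c̄ y c` scales `re y, im_I y` by `|c|²` and rotates
`(im_J y, im_K y)`. [folklore] -/
theorem star_axial_mul_mul_axial (c y : ℍ) (hJ : c.imJ = 0) (hK : c.imK = 0) :
    (star c * y * c).re = (c.re ^ 2 + c.imI ^ 2) * y.re ∧ (star c * y * c).imI = (c.re ^ 2 + c.imI ^ 2) * y.imI ∧
      (star c * y * c).imJ = (c.re ^ 2 - c.imI ^ 2) * y.imJ + 2 * c.re * c.imI * y.imK ∧
      (star c * y * c).imK = (c.re ^ 2 - c.imI ^ 2) * y.imK - 2 * c.re * c.imI * y.imJ := by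
  refine ⟨?_, ?_, ?_, ?_⟩ <;> simp [hJ, hK] <;> ring

/-- **The `T`-stratum transversal**: for a unit axial `c` (`im_J c = im_K c = 0`, `(re c)² + (im_I c)² = 1`),
`16 (im_I c)² (im_I y)² ((im_J y)² + (im_K y)²) ≤ ‖y·(c̄yc) − (c̄yc)·y‖²` — the commutator of a letter with its conjugate by `c` sees the
product of its axial and its transversal components. [folklore] -/
theorem sixteen_mul_le_norm_comm_conj_sq (c y : ℍ) (hJ : c.imJ = 0) (hK : c.imK = 0) (h1 : c.re ^ 2 + c.imI ^ 2 = 1) :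
    16 * c.imI ^ 2 * y.imI ^ 2 * (y.imJ ^ 2 + y.imK ^ 2) ≤ ‖y * (star c * y * c) - (star c * y * c) * y‖ ^ 2 := by
  obtain ⟨hre, hI, hJ', hK'⟩ := star_axial_mul_mul_axial c y hJ hK
  rw [h1, one_mul] at hre hI
  rw [norm_comm_sq, hI, hJ', hK']
  set r := c.re
  set s := c.imI
  have hr : r ^ 2 = 1 - s ^ 2 := by linarith
  have e : 4 * ((y.imJ * ((r ^ 2 - s ^ 2) * y.imK - 2 * r * s * y.imJ) - y.imK * ((r ^ 2 - s ^ 2) * y.imJ + 2 * r * s * y.imK)) ^ 2 +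
        (y.imK * y.imI - y.imI * ((r ^ 2 - s ^ 2) * y.imK - 2 * r * s * y.imJ)) ^ 2 +
        (y.imI * ((r ^ 2 - s ^ 2) * y.imJ + 2 * r * s * y.imK) - y.imJ * y.imI) ^ 2) =
      4 * (y.imJ * ((r ^ 2 - s ^ 2) * y.imK - 2 * r * s * y.imJ) - y.imK * ((r ^ 2 - s ^ 2) * y.imJ + 2 * r * s * y.imK)) ^ 2 +
        4 * y.imI ^ 2 * ((y.imJ ^ 2 + y.imK ^ 2) * ((r ^ 2 - s ^ 2 - 1) ^ 2 + 4 * r ^ 2 * s ^ 2)) := by ring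
  rw [e]
  have e2 : (r ^ 2 - s ^ 2 - 1) ^ 2 + 4 * r ^ 2 * s ^ 2 = 4 * s ^ 2 := by rw [hr]; ring
  rw [e2]
  nlinarith [sq_nonneg (y.imJ * ((r ^ 2 - s ^ 2) * y.imK - 2 * r * s * y.imJ) - y.imK * ((r ^ 2 - s ^ 2) * y.imJ + 2 * r * s * y.imK))]

/-- **Commutator with an axial letter**: `‖cy − yc‖² = 4(im_I c)²((im_J y)² + (im_K y)²)` for `im_J c = im_K c = 0`. [folklore] -/
theorem norm_comm_axial_sq (c y : ℍ) (hJ : c.imJ = 0) (hK : c.imK = 0) :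
    ‖c * y - y * c‖ ^ 2 = 4 * c.imI ^ 2 * (y.imJ ^ 2 + y.imK ^ 2) := by
  rw [norm_comm_sq, hJ, hK]; ring

/-- **Transversal components of a commutator**: `4(im_I y · im_J w − im_J y · im_I w)² ≤ ‖yw − wy‖²` and the same with `K`. [folklore] -/
theorem four_mul_sq_le_norm_comm_sq_J (y w : ℍ) : 4 * (y.imI * w.imJ - y.imJ * w.imI) ^ 2 ≤ ‖y * w - w * y‖ ^ 2 := by
  rw [norm_comm_sq]
  nlinarith [sq_nonneg (y.imJ * w.imK - y.imK * w.imJ), sq_nonneg (y.imK * w.imI - y.imI * w.imK)]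

/-- The `K`-component version. [folklore] -/
theorem four_mul_sq_le_norm_comm_sq_K (y w : ℍ) : 4 * (y.imK * w.imI - y.imI * w.imK) ^ 2 ≤ ‖y * w - w * y‖ ^ 2 := by
  rw [norm_comm_sq]
  nlinarith [sq_nonneg (y.imJ * w.imK - y.imK * w.imJ), sq_nonneg (y.imI * w.imJ - y.imJ * w.imI)]

/-! ## §2 Pointwise consequences of the σ-twisted relations for four unit quaternions -/

/-- `‖q₁ − q̄₃q₀q₃‖ = ‖q₃q₁ − q₀q₃‖` for a unit `q₃`: the first twisted relation puts `q₁` in the `t`-ball around `q̄₃ q₀ q₃`. [folklore] -/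
theorem norm_sub_conj_eq {q₃ : ℍ} (h₃ : ‖q₃‖ = 1) (q₀ q₁ : ℍ) :
    ‖q₁ - star q₃ * q₀ * q₃‖ = ‖q₃ * q₁ - q₀ * q₃‖ := by
  have hus : q₃ * star q₃ = 1 := by
    rw [Quaternion.self_mul_star, Quaternion.normSq_eq_norm_mul_self, h₃, mul_one, Quaternion.coe_one]
  have e : q₃ * (q₁ - star q₃ * q₀ * q₃) = q₃ * q₁ - q₀ * q₃ := by
    rw [mul_sub]
    congr 1
    calc q₃ * (star q₃ * q₀ * q₃) = (q₃ * star q₃) * q₀ * q₃ := by simp only [mul_assoc]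
      _ = q₀ * q₃ := by rw [hus, one_mul]
  rw [← e, norm_mul, h₃, one_mul]

/-- **The difference `D = q₁ − q₀` is massive where `re q₃ ≠ 0`**: `|re q₃|·‖q₁ − q₀‖ ≤ t` from the two twisted relations
(their difference is the anticommutator `q₃D + Dq₃`). [folklore] -/
theorem abs_re_mul_norm_sub_le {q₀ q₁ q₃ : ℍ} {t : ℝ} (hT0 : ‖q₃ * q₁ - q₀ * q₃‖ ≤ t) (hT1 : ‖q₃ * q₀ - q₁ * q₃‖ ≤ t) :
    |q₃.re| * ‖q₁ - q₀‖ ≤ t := by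
  have e : q₃ * (q₁ - q₀) + (q₁ - q₀) * q₃ = (q₃ * q₁ - q₀ * q₃) - (q₃ * q₀ - q₁ * q₃) := by
    simp only [mul_sub, sub_mul]; abel
  have h := two_mul_abs_re_mul_norm_le_norm_anticomm q₃ (q₁ - q₀)
  rw [e] at h
  have h2 : ‖(q₃ * q₁ - q₀ * q₃) - (q₃ * q₀ - q₁ * q₃)‖ ≤ t + t := (norm_sub_le _ _).trans (add_le_add hT0 hT1)
  nlinarith [abs_nonneg q₃.re, norm_nonneg (q₁ - q₀)]

/-- **The commutator `[q₃, q₀]` is controlled by `D`**: `‖q₃q₀ − q₀q₃‖ ≤ t + ‖q₃‖·‖q₁ − q₀‖` (the sum of the twisted relations is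
`[q₃, q₀ + q₁]`). [folklore] -/
theorem norm_comm_le_add_norm_sub {q₀ q₁ q₃ : ℍ} {t : ℝ} (hT0 : ‖q₃ * q₁ - q₀ * q₃‖ ≤ t) (hT1 : ‖q₃ * q₀ - q₁ * q₃‖ ≤ t) :
    ‖q₃ * q₀ - q₀ * q₃‖ ≤ t + ‖q₃‖ * ‖q₁ - q₀‖ := by
  have e : (2 : ℝ) • (q₃ * q₀ - q₀ * q₃) = ((q₃ * q₁ - q₀ * q₃) + (q₃ * q₀ - q₁ * q₃)) - (q₃ * (q₁ - q₀) - (q₁ - q₀) * q₃) := by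
    rw [two_smul]; simp only [mul_sub, sub_mul]; abel
  have h1 : ‖(2 : ℝ) • (q₃ * q₀ - q₀ * q₃)‖ ≤ (t + t) + (‖q₃‖ * ‖q₁ - q₀‖ + ‖q₁ - q₀‖ * ‖q₃‖) := by
    rw [e]
    refine (norm_sub_le _ _).trans (add_le_add ((norm_add_le _ _).trans (add_le_add hT0 hT1)) ?_)
    exact (norm_sub_le _ _).trans (add_le_add (norm_mul_le _ _) (norm_mul_le _ _))
  rw [norm_smul, Real.norm_eq_abs, abs_of_pos (by norm_num : (0 : ℝ) < 2)] at h1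
  nlinarith [norm_nonneg q₃, norm_nonneg (q₁ - q₀)]

/-- **Region A** (`|re q₃| ≥ 1/2`): `‖q₃q₀ − q₀q₃‖ ≤ 3t` — there the three letters `q₀, q₂, q₃` pairwise commute up to `3t`. [folklore] -/
theorem norm_comm_le_three_mul {q₀ q₁ q₃ : ℍ} {t : ℝ} (h₃ : ‖q₃‖ = 1) (hr : 1 / 2 ≤ |q₃.re|)
    (hT0 : ‖q₃ * q₁ - q₀ * q₃‖ ≤ t) (hT1 : ‖q₃ * q₀ - q₁ * q₃‖ ≤ t) : ‖q₃ * q₀ - q₀ * q₃‖ ≤ 3 * t := by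
  have h1 := abs_re_mul_norm_sub_le hT0 hT1
  have h2 := norm_comm_le_add_norm_sub hT0 hT1
  rw [h₃, one_mul] at h2
  nlinarith [norm_nonneg (q₁ - q₀)]

/-- **Constraint (c)**: `|re q₃|·‖q₃q₀ − q₀q₃‖ ≤ 2t` for a unit `q₃` — the axis component of `q₃` against the transversal part of `q₀`. [folklore] -/
theorem abs_re_mul_norm_comm_le {q₀ q₁ q₃ : ℍ} {t : ℝ} (h₃ : ‖q₃‖ = 1)
    (hT0 : ‖q₃ * q₁ - q₀ * q₃‖ ≤ t) (hT1 : ‖q₃ * q₀ - q₁ * q₃‖ ≤ t) : |q₃.re| * ‖q₃ * q₀ - q₀ * q₃‖ ≤ 2 * t := by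
  have h1 := abs_re_mul_norm_sub_le hT0 hT1
  have h2 := norm_comm_le_add_norm_sub hT0 hT1
  rw [h₃, one_mul] at h2
  have hr1 : |q₃.re| ≤ 1 := (abs_re_le_norm q₃).trans h₃.le
  have ht : 0 ≤ t := (norm_nonneg _).trans hT0
  calc |q₃.re| * ‖q₃ * q₀ - q₀ * q₃‖ ≤ |q₃.re| * (t + ‖q₁ - q₀‖) := mul_le_mul_of_nonneg_left h2 (abs_nonneg _)
    _ = |q₃.re| * t + |q₃.re| * ‖q₁ - q₀‖ := by ring
    _ ≤ 1 * t + t := add_le_add (mul_le_mul_of_nonneg_right hr1 ht) h1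
    _ = 2 * t := by ring

/-- **Constraint (d)**: `‖q₀·(q̄₃q₀q₃) − (q̄₃q₀q₃)·q₀‖ ≤ 3t` when `‖q₀‖ ≤ 1`, `‖q₃‖ = 1`: the commutator of `q₀` with `q₁` is within
`2‖q₁ − q̄₃q₀q₃‖ ≤ 2t` of the commutator with the conjugate. [folklore] -/
theorem norm_comm_conj_le {q₀ q₁ q₃ : ℍ} {t : ℝ} (h₀ : ‖q₀‖ ≤ 1) (h₃ : ‖q₃‖ = 1)
    (h01 : ‖q₀ * q₁ - q₁ * q₀‖ ≤ t) (hT0 : ‖q₃ * q₁ - q₀ * q₃‖ ≤ t) :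
    ‖q₀ * (star q₃ * q₀ * q₃) - (star q₃ * q₀ * q₃) * q₀‖ ≤ 3 * t := by
  set w := star q₃ * q₀ * q₃ with hw
  have hd : ‖q₁ - w‖ ≤ t := by rw [hw, norm_sub_conj_eq h₃]; exact hT0
  have e : q₀ * w - w * q₀ = (q₀ * q₁ - q₁ * q₀) - (q₀ * (q₁ - w) - (q₁ - w) * q₀) := by
    simp only [mul_sub, sub_mul]; abel
  rw [e]
  refine (norm_sub_le _ _).trans ?_
  have h2 : ‖q₀ * (q₁ - w) - (q₁ - w) * q₀‖ ≤ ‖q₀‖ * ‖q₁ - w‖ + ‖q₁ - w‖ * ‖q₀‖ :=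
    (norm_sub_le _ _).trans (add_le_add (norm_mul_le _ _) (norm_mul_le _ _))
  have ht : 0 ≤ t := (norm_nonneg _).trans hT0
  nlinarith [norm_nonneg q₀, norm_nonneg (q₁ - w), mul_le_mul h₀ hd (norm_nonneg _) zero_le_one]


/-! ## §3 The straightened ball-model coordinates of the two inner letters -/

/-- Conjugation by a unit quaternion is multiplicative on triple products. [folklore] -/
theorem conj_mul_three {u : ℍ} (hu : ‖u‖ = 1) (a b d : ℍ) :
    star u * (a * b * d) * u = (star u * a * u) * (star u * b * u) * (star u * d * u) := by
  have hus : u * star u = 1 := by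
    rw [Quaternion.self_mul_star, Quaternion.normSq_eq_norm_mul_self, hu, mul_one, Quaternion.coe_one]
  calc star u * (a * b * d) * u = star u * a * (u * star u) * b * (u * star u) * d * u := by
        rw [hus]; simp only [mul_one, mul_assoc]
    _ = (star u * a * u) * (star u * b * u) * (star u * d * u) := by simp only [mul_assoc]

/-- **The straightened outer letter is axial**: if `ū q₃ u = re q₃ ± ‖Im q₃‖·i` then `c := ū q₃ u` has `im_J c = im_K c = 0`,
`re c = re q₃` and `(re c)² + (im_I c)² = 1`, `(im_I c)² = 1 − (re q₃)²` for a unit `q₃`. [folklore] -/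
theorem axial_of_straighten {q₃ u : ℍ} (h₃ : ‖q₃‖ = 1)
    (hstr : star u * q₃ * u = axisPoint q₃ ∨ star u * q₃ * u = star (axisPoint q₃)) :
    (star u * q₃ * u).imJ = 0 ∧ (star u * q₃ * u).imK = 0 ∧ (star u * q₃ * u).re = q₃.re ∧
      (star u * q₃ * u).re ^ 2 + (star u * q₃ * u).imI ^ 2 = 1 ∧ (star u * q₃ * u).imI ^ 2 = 1 - q₃.re ^ 2 := by
  have hn : q₃.re ^ 2 + ‖q₃.im‖ ^ 2 = 1 := by
    have := sq_norm_im_eq q₃; rw [h₃] at this; linarith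
  rcases hstr with h | h <;> rw [h] <;> simp [axisPoint] <;> constructor <;> nlinarith

/-- **Constraint (b) in coordinates**: `‖q₃x − xq₃‖ ≤ t`, `|re q₃| < 1/2` ⇒ the straightened letter `y = ū x u` has `|im_J y|, |im_K y| ≤ t`.
[folklore] -/
theorem absJK_le_of_comm_le {q₃ u x : ℍ} {t : ℝ} (h₃ : ‖q₃‖ = 1) (hr : |q₃.re| < 1 / 2) (hu : ‖u‖ = 1)
    (hstr : star u * q₃ * u = axisPoint q₃ ∨ star u * q₃ * u = star (axisPoint q₃)) (ht : 0 ≤ t)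
    (hb : ‖q₃ * x - x * q₃‖ ≤ t) : |(star u * x * u).imJ| ≤ t ∧ |(star u * x * u).imK| ≤ t := by
  obtain ⟨hJ, hK, -, -, hI2⟩ := axial_of_straighten h₃ hstr
  have hr2 : q₃.re ^ 2 < 1 / 4 := by
    have := abs_lt.1 hr; nlinarith
  have hc : ‖(star u * q₃ * u) * (star u * x * u) - (star u * x * u) * (star u * q₃ * u)‖ ≤ t := by
    rw [comm_conj_of_norm_eq_one hu, norm_conj_of_norm_eq_one hu]; exact hb
  have hsq := pow_le_pow_left₀ (norm_nonneg _) hc 2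
  rw [norm_comm_axial_sq _ _ hJ hK, hI2] at hsq
  constructor
  · exact abs_le_of_sq_le_sq' (by nlinarith [sq_nonneg (star u * x * u).imK]) ht |> fun h => abs_le.2 h
  · exact abs_le_of_sq_le_sq' (by nlinarith [sq_nonneg (star u * x * u).imJ]) ht |> fun h => abs_le.2 h

/-- **Constraint (c) in coordinates**: `|re q₃|·‖q₃x − xq₃‖ ≤ 2t` ⇒ `|re q₃|·|im_J y| ≤ 2t` and `|re q₃|·|im_K y| ≤ 2t`. [folklore] -/
theorem abs_re_mul_absJK_le {q₃ u x : ℍ} {t : ℝ} (h₃ : ‖q₃‖ = 1) (hr : |q₃.re| < 1 / 2) (hu : ‖u‖ = 1)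
    (hstr : star u * q₃ * u = axisPoint q₃ ∨ star u * q₃ * u = star (axisPoint q₃)) (ht : 0 ≤ t)
    (hc : |q₃.re| * ‖q₃ * x - x * q₃‖ ≤ 2 * t) :
    |q₃.re| * |(star u * x * u).imJ| ≤ 2 * t ∧ |q₃.re| * |(star u * x * u).imK| ≤ 2 * t := by
  obtain ⟨hJ, hK, -, -, hI2⟩ := axial_of_straighten h₃ hstr
  have hr2 : q₃.re ^ 2 < 1 / 4 := by
    have := abs_lt.1 hr; nlinarith
  have hc' : |q₃.re| * ‖(star u * q₃ * u) * (star u * x * u) - (star u * x * u) * (star u * q₃ * u)‖ ≤ 2 * t := by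
    rw [comm_conj_of_norm_eq_one hu, norm_conj_of_norm_eq_one hu]; exact hc
  have hsq := pow_le_pow_left₀ (by positivity) hc' 2
  rw [mul_pow, norm_comm_axial_sq _ _ hJ hK, hI2, sq_abs] at hsq
  have h2t : 0 ≤ 2 * t := by positivity
  set y := star u * x * u
  constructor
  · have hsq' : (|q₃.re| * |y.imJ|) ^ 2 ≤ (2 * t) ^ 2 := by
      rw [mul_pow, sq_abs, sq_abs]
      nlinarith [sq_nonneg y.imK, sq_nonneg q₃.re, mul_nonneg (sq_nonneg q₃.re) (sq_nonneg y.imK)]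
    exact (pow_le_pow_iff_left₀ (by positivity) h2t two_ne_zero).1 hsq'
  · have hsq' : (|q₃.re| * |y.imK|) ^ 2 ≤ (2 * t) ^ 2 := by
      rw [mul_pow, sq_abs, sq_abs]
      nlinarith [sq_nonneg y.imJ, sq_nonneg q₃.re, mul_nonneg (sq_nonneg q₃.re) (sq_nonneg y.imJ)]
    exact (pow_le_pow_iff_left₀ (by positivity) h2t two_ne_zero).1 hsq'

/-- **Constraint (d) in coordinates**: `‖x(q̄₃xq₃) − (q̄₃xq₃)x‖ ≤ 3t` ⇒ `|im_I y|·|im_J y| ≤ t` and `|im_I y|·|im_K y| ≤ t`. [folklore] -/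
theorem absI_mul_absJK_le {q₃ u x : ℍ} {t : ℝ} (h₃ : ‖q₃‖ = 1) (hr : |q₃.re| < 1 / 2) (hu : ‖u‖ = 1)
    (hstr : star u * q₃ * u = axisPoint q₃ ∨ star u * q₃ * u = star (axisPoint q₃)) (ht : 0 ≤ t)
    (hd : ‖x * (star q₃ * x * q₃) - (star q₃ * x * q₃) * x‖ ≤ 3 * t) :
    |(star u * x * u).imI| * |(star u * x * u).imJ| ≤ t ∧ |(star u * x * u).imI| * |(star u * x * u).imK| ≤ t := by
  obtain ⟨hJ, hK, -, h1, hI2⟩ := axial_of_straighten h₃ hstr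
  have hr2 : q₃.re ^ 2 < 1 / 4 := by
    have := abs_lt.1 hr; nlinarith
  set c := star u * q₃ * u with hcdef
  set y := star u * x * u with hydef
  have hconj : star u * (star q₃ * x * q₃) * u = star c * y * c := by
    rw [conj_mul_three hu, hcdef, hydef, star_mul, star_mul, star_star, mul_assoc (star u) (star q₃) u]
  have hd' : ‖y * (star c * y * c) - (star c * y * c) * y‖ ≤ 3 * t := by
    rw [← hconj, hydef, comm_conj_of_norm_eq_one hu, norm_conj_of_norm_eq_one hu]; exact hd
  have hsq := pow_le_pow_left₀ (norm_nonneg _) hd' 2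
  have h16 := (sixteen_mul_le_norm_comm_conj_sq c y hJ hK h1).trans hsq
  rw [hI2] at h16
  constructor
  · have hsq' : (|y.imI| * |y.imJ|) ^ 2 ≤ t ^ 2 := by
      rw [mul_pow, sq_abs, sq_abs]
      nlinarith [sq_nonneg y.imK, sq_nonneg y.imI, mul_nonneg (sq_nonneg y.imI) (sq_nonneg y.imK)]
    exact (pow_le_pow_iff_left₀ (by positivity) ht two_ne_zero).1 hsq'
  · have hsq' : (|y.imI| * |y.imK|) ^ 2 ≤ t ^ 2 := by
      rw [mul_pow, sq_abs, sq_abs]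
      nlinarith [sq_nonneg y.imJ, sq_nonneg y.imI, mul_nonneg (sq_nonneg y.imI) (sq_nonneg y.imJ)]
    exact (pow_le_pow_iff_left₀ (by positivity) ht two_ne_zero).1 hsq'

/-- **Constraint (a) in coordinates**: `‖x₀x₂ − x₂x₀‖ ≤ t`, `‖x₀‖ < 1` and `|im_J y₂|, |im_K y₂| ≤ t` ⇒ `|im_I y₂|·|im_J y₀| ≤ 2t` and
`|im_I y₂|·|im_K y₀| ≤ 2t`. [folklore] -/
theorem absI₂_mul_absJK₀_le {u x₀ x₂ : ℍ} {t : ℝ} (hu : ‖u‖ = 1) (hx₀ : ‖x₀‖ < 1) (ht : 0 ≤ t)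
    (hJ₂ : |(star u * x₂ * u).imJ| ≤ t) (hK₂ : |(star u * x₂ * u).imK| ≤ t) (ha : ‖x₀ * x₂ - x₂ * x₀‖ ≤ t) :
    |(star u * x₂ * u).imI| * |(star u * x₀ * u).imJ| ≤ 2 * t ∧ |(star u * x₂ * u).imI| * |(star u * x₀ * u).imK| ≤ 2 * t := by
  set y₀ := star u * x₀ * u with hy₀
  set y₂ := star u * x₂ * u with hy₂
  have ha' : ‖y₀ * y₂ - y₂ * y₀‖ ≤ t := by
    rw [hy₀, hy₂, comm_conj_of_norm_eq_one hu, norm_conj_of_norm_eq_one hu]; exact ha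
  have hsq := pow_le_pow_left₀ (norm_nonneg _) ha' 2
  have hb₀ : |y₀.imI| ≤ 1 := ((abs_imI_le_norm y₀).trans (by rw [hy₀, norm_conj_of_norm_eq_one hu])).trans hx₀.le
  have hJc : |y₀.imI * y₂.imJ - y₀.imJ * y₂.imI| ≤ t / 2 := by
    have h4 := (four_mul_sq_le_norm_comm_sq_J y₀ y₂).trans hsq
    exact abs_le_of_sq_le_sq' (by nlinarith) (by positivity) |> fun h => abs_le.2 h
  have hKc : |y₀.imK * y₂.imI - y₀.imI * y₂.imK| ≤ t / 2 := by
    have h4 := (four_mul_sq_le_norm_comm_sq_K y₀ y₂).trans hsq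
    exact abs_le_of_sq_le_sq' (by nlinarith) (by positivity) |> fun h => abs_le.2 h
  have hIJ : |y₀.imI * y₂.imJ| ≤ t := by
    rw [abs_mul]; nlinarith [mul_le_mul hb₀ hJ₂ (abs_nonneg _) zero_le_one]
  have hIK : |y₀.imI * y₂.imK| ≤ t := by
    rw [abs_mul]; nlinarith [mul_le_mul hb₀ hK₂ (abs_nonneg _) zero_le_one]
  constructor
  · have e : y₂.imI * y₀.imJ = y₀.imI * y₂.imJ - (y₀.imI * y₂.imJ - y₀.imJ * y₂.imI) := by ring
    rw [← abs_mul, e]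
    refine (abs_sub _ _).trans ?_
    linarith
  · have e : y₂.imI * y₀.imK = (y₀.imK * y₂.imI - y₀.imI * y₂.imK) + y₀.imI * y₂.imK := by ring
    rw [← abs_mul, e]
    refine (abs_add_le _ _).trans ?_
    linarith


end Summit.QuantumFields.YangMills.Theorems.SwapVirialDeficit.SigmaTwistedCeiling

end
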